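import Summits.CriticalPhenomena.PercolationContinuityZ3.Theorems.Transplant.PlanarSkeletonConcShift
import Summits.CriticalPhenomena.PercolationContinuityZ3.Theorems.Transplant.SkelCellsConcGLevels
import HarnessLib

/-!
# L7.2 — the generic (D) assembly AT THE CELL GEOMETRY OF RECORD `Skel.cellGeomSG` (p2-g3's L3.1): `concSchemeSG`, `ConcKitAtRunSG`,
# `theta_pos_of_concKitAtRunSG`, and **`samePDropOfSkeletonConcLt_of_concSG_inputs`** — the node of record from finite-volume inputs at `p`
# and, at every nearby density, planar cells `C`, a slack-well-formed schedule `Λ` (`Skel.WFS C Λ`), constants and the run-restricted obligations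
# (generic twin of `BoxProdZ2ConcAssemblyG`, p220793, in the run form of `BoxProdZ2ConcClosureRun`)

builds on p205010 (kernel theorem, internal audit signed; external expert review pending) — nothing in this file uses p205010.
Status sentence (coordinator 2026-08-20T04:30Z): "θ(p_c) = 0 on ℤ^d, all d ≥ 2 — kernel-verified (Lean 4/Mathlib, standard axioms); internal adversarial
audit SIGNED 2026-08-20 04:29Z; external expert review pending."
Lane `prim-bschramm-*`, seat `prim-bschramm-stmt` (gen 7); helper file (`--supports stmt-CriticalPhenomena-4575`).
GENERAL-NODE programme (SHEAR-SCOPE §3.9 Layer 7; CONC-PARAMS-GENERIC.md §5): composition of `SkelConc.samePDropOfSkeletonConcLt_of_inputs_run_centred`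
(p232538: the assembly top, re-centred so that `Φ.φ t = 0`) with p2-g3's records `Skel.runGeomSG / anchGeomSG / sepGeom₂SG / exitGeomSG /
stepsGeomSG / levelGeomSG` for `Skel.cellGeomSG Φ C t Λ` under `Skel.WFS C Λ` and `Φ.φ t = 0`.

* `SkelConc.concSchemeSG Φ C t Λ q δc := ⟨Skel.cellGeomSG Φ C t Λ, q, δc⟩` (anchor type `ℕ`);
* **`SkelConc.ConcKitAtRunSG Φ C t Λ q δc ε' δ₂`** := `KSchA.KitAtRun G (concSchemeSG …) (Skel.faceDataSG Φ C t Λ) δ₂ ε'` — the three run-restricted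
  probabilistic obligations (root (32), target lemma at the faces, corridor bound) at the geometry of record: THE target of the generic instance's
  step (B), to be split into the residues (R)/(F)/(C) by the generic `KitResiduesRun`;
* **`theta_pos_of_concKitAtRunSG`** — `Skel.WFS C Λ`, `Φ.φ t = 0`, `0 < q`, `δc ≤ 1`, `ε ≤ 2⁻³²`, `0 ≤ ε'`, `δ₂ ≤ 1`, `4((1-δ₂)^K + ε') ≤ ε`,
  `ConcKitAtRunSG …` ⟹ `0 < θ_t(q)`; `criticalProb_le_of_concKitAtRunSG`;
* **`samePDropOfSkeletonConcLt_of_concSG_inputs`** — (A) a finite family of finite-volume strict lower bounds holding at `p` + (B) for every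
  `q ∈ [p/2, p]` where they hold and `Φ.CylSubcritical q`: `∃ C Λ δc ε' δ₂, Skel.WFS C Λ ∧ δc ≤ 1 ∧ 0 ≤ ε' ∧ δ₂ ≤ 1 ∧ 4((1-δ₂)^K + ε') ≤ 2⁻³² ∧
  ConcKitAtRunSG Φ C t Λ q δc ε' δ₂` — for centred skeletons (`Φ.φ t = 0`) — ⟹ `SamePDropOfSkeletonConcLt`.
[cite: KozmaNitzan2024, §4 Theorem 6 (pp. 25–31); §1 p. 2 (approach 1)] [cite: GrimmettPercolation1999, §7.3 pp. 162, 169]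
-/

noncomputable section

open MeasureTheory ProbabilityTheory
open scoped ENNReal Classical

namespace Summit.CriticalPhenomena.PercolationContinuityZ3.Theorems

namespace Transplant

namespace SkelConc

open Literature.Probability.Percolation Literature.Probability.LatticeModels SimpleGraph KNCells
open BoxProdZ2 (ConcRadiiG)

variable {V : Type} [DecidableEq V] {G : SimpleGraph V} [G.LocallyFinite] (Φ : PlanarSkeletonConc G)

/-! ## §1 The scheme and its run-restricted obligations at the geometry of record -/

/-- **The concentric anchored-cells scheme at density `q` over the skeleton** (cells `Skel.cellGeomSG`, chain accuracy `δc`).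
[cite: KozmaNitzan2024, §4 pp. 25–27] -/
abbrev concSchemeSG (C : PCells) (t : V) (Λ : ConcRadiiG) (q : unitInterval) (δc : ℝ) : KSchA V ℕ :=
  ⟨Skel.cellGeomSG Φ C t Λ, q, δc⟩

/-- **The three run-restricted probabilistic obligations at density `q` for `Skel.cellGeomSG`** (face data `Skel.faceDataSG`): the generic
`KSchA.KitAtRun` at `concSchemeSG`.  THE target of the generic instance's step (B). [cite: KozmaNitzan2024, §4 (30), (32), Lemma 10 at the faces, Lemmas 11–12] -/
abbrev ConcKitAtRunSG (C : PCells) (t : V) (Λ : ConcRadiiG) (q : unitInterval) (δc ε' δ₂ : ℝ) : Prop :=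
  KSchA.KitAtRun G (concSchemeSG Φ C t Λ q δc) (Skel.faceDataSG Φ C t Λ) δ₂ ε'

/-! ## §2 The obligations give `θ_t(q) > 0` -/

/-- **`ConcKitAtRunSG` at a positive density gives `θ_t(q) > 0`** (p2-g3's six records for `Skel.cellGeomSG` from `Skel.WFS C Λ` and
`Φ.φ t = 0`; p5-g3's `theta_pos_of_kitAtRun`). [cite: KozmaNitzan2024, §4 Theorem 6 (pp. 25–31)] -/
theorem theta_pos_of_concKitAtRunSG [Countable V] (C : PCells) (t : V) {Λ : ConcRadiiG} (hΛ : Skel.WFS C Λ) (hφ : Φ.φ t = 0)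
    {q : unitInterval} (hq : 0 < (q : ℝ)) {δc ε ε' δ₂ : ℝ} (hδc : δc ≤ 1) (hε : ε ≤ (1 / 2) ^ 32) (hε' : 0 ≤ ε') (hδ₂ : δ₂ ≤ 1)
    (hKε : 4 * ((1 - δ₂) ^ C.K + ε') ≤ ε) (hkit : ConcKitAtRunSG Φ C t Λ q δc ε' δ₂) :
    0 < theta G t q :=
  KSchA.theta_pos_of_kitAtRun (S := concSchemeSG Φ C t Λ q δc) (Skel.runGeomSG Φ C t) (Skel.anchGeomSG Φ C t)
    (Skel.sepGeom₂SG Φ C t hΛ hφ) (Skel.exitGeomSG Φ C t hΛ) (Skel.stepsGeomSG Φ C t hΛ) (Skel.levelGeomSG Φ C t hΛ)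
    hδc hε hε' hδ₂ hKε hq hkit

/-- `p_c(G, t) ≤ q` from the obligations at `q > 0`. [cite: KozmaNitzan2024, §1 p. 2 (approach 1)] -/
theorem criticalProb_le_of_concKitAtRunSG [Countable V] (C : PCells) (t : V) {Λ : ConcRadiiG} (hΛ : Skel.WFS C Λ) (hφ : Φ.φ t = 0)
    {q : unitInterval} (hq : 0 < (q : ℝ)) {δc ε ε' δ₂ : ℝ} (hδc : δc ≤ 1) (hε : ε ≤ (1 / 2) ^ 32) (hε' : 0 ≤ ε') (hδ₂ : δ₂ ≤ 1)
    (hKε : 4 * ((1 - δ₂) ^ C.K + ε') ≤ ε) (hkit : ConcKitAtRunSG Φ C t Λ q δc ε' δ₂) :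
    criticalProb G t ≤ q :=
  OrbitQuotient.criticalProb_le_of_theta_pos _ _ q (theta_pos_of_concKitAtRunSG Φ C t hΛ hφ hq hδc hε hε' hδ₂ hKε hkit)

end SkelConc

namespace SkelConc

open Literature.Probability.Percolation Literature.Probability.LatticeModels SimpleGraph KNCells
open BoxProdZ2 (ConcRadiiG)

/-! ## §3 The node of record from the concentric inputs at the geometry of record -/

/-- **THE GENERIC (D) ASSEMBLY at `Skel.cellGeomSG`** (centred skeletons, `Φ.φ t = 0`): (A) a finite family of finite-volume strict lower bounds
holding at `p` and (B) for every `q ∈ [p/2, p]` where they hold and the cylinders are subcritical, planar cells `C`, a schedule `Λ` with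
`Skel.WFS C Λ`, constants and `ConcKitAtRunSG Φ C t Λ q δc ε' δ₂` ⟹ `SamePDropOfSkeletonConcLt` (via `samePDropOfSkeletonConcLt_of_inputs_run_centred`).
[cite: KozmaNitzan2024, §1 p. 2 (approach 1), §4 Theorem 6 (pp. 25–31)] -/
theorem samePDropOfSkeletonConcLt_of_concSG_inputs
    (h : ∀ {V : Type} [DecidableEq V] [Countable V] (G : SimpleGraph V) [G.LocallyFinite] (Φ : PlanarSkeletonConc G),
      G.Connected → ∀ t ∈ Φ.types, Φ.φ t = 0 → ∀ p : unitInterval, (p : ℝ) < 1 →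
        (∀ᵐ ω ∂bondPercolation G p, numInfiniteClusters ω ≤ 1) → Φ.toPlanarSkeleton.CylSubcritical p → 0 < theta G t p →
          ∃ (ι : Type) (s : Finset ι) (A : ι → Set (BondConfig V)) (F : ι → Finset (Sym2 V)) (c : ι → ℝ),
            (∀ i ∈ s, DeterminedBy (A i) (↑(F i) : Set (Sym2 V))) ∧
            (∀ i ∈ s, c i < (bondPercolation G p).real (A i)) ∧
            ∀ q : unitInterval, (p : ℝ) / 2 ≤ q → (q : ℝ) ≤ p →
              (∀ i ∈ s, c i < (bondPercolation G q).real (A i)) →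
              Φ.toPlanarSkeleton.CylSubcritical q →
                ∃ (C : PCells) (Λ : ConcRadiiG) (δc ε' δ₂ : ℝ), Skel.WFS C Λ ∧ δc ≤ 1 ∧ 0 ≤ ε' ∧ δ₂ ≤ 1 ∧
                  4 * ((1 - δ₂) ^ C.K + ε') ≤ (1 / 2) ^ 32 ∧ ConcKitAtRunSG Φ C t Λ q δc ε' δ₂) :
    SamePDropOfSkeletonConcLt := by
  refine samePDropOfSkeletonConcLt_of_inputs_run_centred fun {V} _ _ G _ Φ hc t ht h0 p hp1 hU hC hθ => ?_
  obtain ⟨ι, s, A, F, c, hA, hc', hstep⟩ := h G Φ hc t ht h0 p hp1 hU hC hθ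
  refine ⟨ι, s, A, F, c, hA, hc', fun q hq1 hq2 hcq hCq => ?_⟩
  obtain ⟨C, Λ, δc, ε', δ₂, hΛ, hδc, hε', hδ₂, hKε, hkit⟩ := hstep q hq1 hq2 hcq hCq
  exact ⟨ℕ, concSchemeSG Φ C t Λ q δc, Skel.faceDataSG Φ C t Λ, Skel.levelDataS Φ C, ε', δ₂, rfl, rfl,
    Skel.runGeomSG Φ C t, Skel.anchGeomSG Φ C t, Skel.sepGeom₂SG Φ C t hΛ h0, Skel.exitGeomSG Φ C t hΛ,
    Skel.stepsGeomSG Φ C t hΛ, Skel.levelGeomSG Φ C t hΛ, hδc, hε', hδ₂, hKε, hkit⟩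

end SkelConc

end Transplant

end Summit.CriticalPhenomena.PercolationContinuityZ3.Theorems

end
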